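import Mathlib.NumberTheory.Cyclotomic.Gal
import Mathlib.NumberTheory.NumberField.Units.Basic
import Mathlib.FieldTheory.AlgebraicClosure
import Mathlib.RingTheory.RootsOfUnity.AlgebraicallyClosed
import Literature.FieldTheory.Kummer.RadicalLattice
import Literature.FieldTheory.Kummer.AbelianRadicalDescent
import Literature.FieldTheory.Kummer.DivisionSequences
import HarnessLib

/-!
# Radicals over `ℚ(μ_∞)`: bounded denominators in finite extensions of `ℚ(μ_∞)`

Let `Ω` be an algebraically closed field of characteristic `0`, `μ` its roots of unity, and
`F = ℚ(μ, θ₁, …, θ_q, v₁, …, v_t) ⊆ Ω` with the `θᵢ, vₗ` algebraic over `ℚ` — a finite extension of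
`ℚ(μ)`. If `v₁, …, v_t` are multiplicatively independent modulo roots of unity, there is `m ≥ 1`
such that `yᴺ = ζ ∏ vₗ^{eₗ}` with `y ∈ F`, `ζ ∈ μ` forces `N ∣ m eₗ` for all `l`
(Zilber 2006, §2; Bays–Zilber 2011, Prop. 2.5, second case, for `F` algebraic: the group
`Fˣ/μ` is locally free). Proof: `F ⊆ k(μ)` for the number field `k = ℚ(θ, v)`; a given `y` lies in
a cyclotomic extension `k(ζ_M)`, which is abelian over `k`, so by the descent lemma
(`AbelianRadicalDescent`) `y ^ w ∈ kˣ μ` for the exponent `w` of `μ(k)`; then the number-field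
bound (`RadicalLattice`, Dirichlet's `S`-unit theorem) applies to `y ^ w`.

* `Literature.FieldTheory.Kummer.CyclotomicRadicalBound.exists_dvd_of_mem_closure`.

## References

* B. Zilber, *Covers of the multiplicative group of an algebraically closed field of
  characteristic zero*, J. LMS 74 (2006), §2.
* M. Bays, B. Zilber, *Covers of multiplicative groups of algebraically closed fields of arbitrary
  characteristic*, Bull. LMS 43 (2011), Prop. 2.5.
-/

noncomputable section

open scoped NumberField

namespace Literature.FieldTheory.Kummer

namespace CyclotomicRadicalBound

/-- **Roots of unity of a number field have bounded order**: there is `w ≥ 1` with `θ ^ w = 1`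
for every root of unity `θ ∈ k` (`w = #μ(k)`, Mathlib's `torsionOrder`). [folklore] -/
theorem exists_exponent_rootsOfUnity (K : Type*) [Field K] [NumberField K] :
    ∃ w : ℕ, 0 < w ∧ ∀ θ : K, ∀ m : ℕ, 0 < m → θ ^ m = 1 → θ ^ w = 1 := by
  refine ⟨NumberField.Units.torsionOrder K, NumberField.Units.torsionOrder_pos K,
    fun θ m hm hθ => ?_⟩
  have hint : IsIntegral ℤ θ := IsIntegral.of_pow hm (by rw [hθ]; exact isIntegral_one)
  let θO : 𝓞 K := ⟨θ, hint⟩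
  have hθO : θO ^ m = 1 := by
    apply NumberField.RingOfIntegers.ext
    change algebraMap (𝓞 K) K (θO ^ m) = algebraMap (𝓞 K) K 1
    rw [map_pow, map_one]
    exact hθ
  let u : (𝓞 K)ˣ := Units.ofPowEqOne θO m hθO hm.ne'
  have hu : u ∈ NumberField.Units.torsion K := by
    rw [NumberField.Units.torsion, CommGroup.mem_torsion, isOfFinOrder_iff_pow_eq_one]
    refine ⟨m, hm, Units.ext ?_⟩
    rw [Units.val_pow_eq_pow_val, Units.val_ofPowEqOne, Units.val_one]
    exact hθO
  rw [← NumberField.Units.rootsOfUnity_eq_torsion, mem_rootsOfUnity] at hu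
  have h1 : θO ^ NumberField.Units.torsionOrder K = 1 := by
    have := congrArg (fun x : (𝓞 K)ˣ => (x : 𝓞 K)) hu
    simpa [Units.val_pow_eq_pow_val, u] using this
  have h2 := congrArg (algebraMap (𝓞 K) K) h1
  rw [map_pow, map_one] at h2
  exact h2

variable {Ω : Type*} [Field Ω]

/-- A monomial that is a root of unity forces trivial exponents: restatement of
`MulIndepModTorsion` for a power equal to `1`. [folklore] -/
theorem eq_zero_of_prod_zpow_pow_eq_one {t : ℕ} {v : Fin t → Ω} (hind : MulIndepModTorsion v)
    (e : Fin t → ℤ) {k : ℕ} (hk : 0 < k) (h : (∏ l, v l ^ e l) ^ k = 1) : e = 0 :=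
  hind e ⟨k, hk, h⟩

variable [CharZero Ω]

/-- **Bounded denominators for radicals over `ℚ(μ)` in a finite extension of `ℚ(μ)`**
(Zilber 2006 §2 / Bays–Zilber 2011 Prop. 2.5, second case, algebraic part): for `θᵢ, vₗ ∈ Ω`
algebraic over `ℚ` with `v` multiplicatively independent modulo roots of unity, there is `m ≥ 1`
such that for all `y ∈ ℚ(μ, θ, v)`, `yᴺ = ζ ∏ vₗ^{eₗ}` (`ζ` a root of unity) implies `N ∣ m eₗ`.
[cite: BaysZilber2011Covers, Prop. 2.5] -/
theorem exists_dvd_of_mem_closure [IsAlgClosed Ω] {q t : ℕ} (θ : Fin q → Ω)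
    (hθ : ∀ i, IsAlgebraic ℚ (θ i)) (v : Fin t → Ω) (hvalg : ∀ l, IsAlgebraic ℚ (v l))
    (hv0 : ∀ l, v l ≠ 0) (hind : MulIndepModTorsion v) :
    ∃ m : ℕ, 0 < m ∧ ∀ y ∈ Subfield.closure (allRoots (1 : Ω) ∪ Set.range θ ∪ Set.range v),
      ∀ (N : ℕ) (e : Fin t → ℤ) (ζ : Ω), ζ ∈ allRoots (1 : Ω) →
        y ^ N = (∏ l, v l ^ e l) * ζ → ∀ l, (N : ℤ) ∣ m * e l := by
  classical
  -- the number field `k = ℚ(θ, v)`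
  set T : Set Ω := Set.range θ ∪ Set.range v with hT
  set k : IntermediateField ℚ Ω := IntermediateField.adjoin ℚ T with hk
  have hTint : ∀ x ∈ T, IsIntegral ℚ x := by
    rintro x (⟨i, rfl⟩ | ⟨l, rfl⟩)
    · exact (hθ i).isIntegral
    · exact (hvalg l).isIntegral
  haveI : FiniteDimensional ℚ k := IntermediateField.finiteDimensional_adjoin hTint
  haveI : NumberField k := NumberField.mk
  have hvk : ∀ l, v l ∈ k := fun l => IntermediateField.subset_adjoin ℚ T (Or.inr ⟨l, rfl⟩)
  have hθk : ∀ i, θ i ∈ k := fun i => IntermediateField.subset_adjoin ℚ T (Or.inl ⟨i, rfl⟩)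
  -- `v` as units of `k`
  let V : Fin t → (k)ˣ := fun l =>
    Units.mk0 ⟨v l, hvk l⟩ (fun h => hv0 l (congrArg Subtype.val h))
  have hVcoe : ∀ f : Fin t → ℤ, algebraMap k Ω (((∏ l, V l ^ f l : kˣ) : k)) = ∏ l, v l ^ f l := by
    intro f
    rw [Units.coe_prod, map_prod]
    refine Finset.prod_congr rfl fun l _ => ?_
    rw [Units.val_zpow_eq_zpow_val, map_zpow₀]
    rfl
  have hVind : ∀ f : Fin t → ℤ, IsOfFinOrder (∏ l, V l ^ f l) → f = 0 := by
    intro f hf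
    obtain ⟨n, hn, hfn⟩ := hf.exists_pow_eq_one
    apply eq_zero_of_prod_zpow_pow_eq_one hind f hn
    rw [← hVcoe f, ← map_pow, ← Units.val_pow_eq_pow_val, hfn, Units.val_one, map_one]
  obtain ⟨m₂, hm₂, hNF⟩ := RadicalLattice.exists_dvd_of_pow_eq_prod_zpow V hVind
  obtain ⟨w, hw, hwK⟩ := exists_exponent_rootsOfUnity k
  refine ⟨m₂ * w, Nat.mul_pos hm₂ hw, fun y hy N e ζ hζ hrel l => ?_⟩
  obtain ⟨M', hM', hζM'⟩ := hζ
  have hζ0 : ζ ≠ 0 := fun h => by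
    rw [h, zero_pow hM'.ne'] at hζM'
    exact zero_ne_one hζM'
  have hprod0 : (∏ l, v l ^ e l) ≠ 0 :=
    Finset.prod_ne_zero_iff.2 fun l _ => zpow_ne_zero _ (hv0 l)
  -- the case `N = 0`
  rcases Nat.eq_zero_or_pos N with hN | hN
  · subst hN
    rw [pow_zero] at hrel
    have h1 : (∏ l, v l ^ e l) ^ M' = 1 := by
      have h2 : (∏ l, v l ^ e l) = ζ⁻¹ := eq_inv_of_mul_eq_one_left hrel.symm
      rw [h2, inv_pow, hζM', inv_one]
    rw [eq_zero_of_prod_zpow_pow_eq_one hind e hM' h1]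
    simp
  have hy0 : y ≠ 0 := by
    intro h
    rw [h, zero_pow hN.ne'] at hrel
    exact (mul_ne_zero hprod0 hζ0) hrel.symm
  -- `y` lies in a cyclotomic extension `k(ζ_M)` of `k`
  let R : ℕ+ → Subfield Ω := fun M => Subfield.closure ((k : Set Ω) ∪ {x | x ^ (M : ℕ) = 1})
  have hRdir : Directed (· ≤ ·) R := by
    intro M₁ M₂
    refine ⟨M₁ * M₂, ?_, ?_⟩
    · refine Subfield.closure_mono (Set.union_subset_union_right _ fun x hx => ?_)
      change x ^ ((M₁ * M₂ : ℕ+) : ℕ) = 1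
      rw [PNat.mul_coe, pow_mul, show x ^ (M₁ : ℕ) = 1 from hx, one_pow]
    · refine Subfield.closure_mono (Set.union_subset_union_right _ fun x hx => ?_)
      change x ^ ((M₁ * M₂ : ℕ+) : ℕ) = 1
      rw [PNat.mul_coe, mul_comm, pow_mul, show x ^ (M₂ : ℕ) = 1 from hx, one_pow]
  have hle : Subfield.closure (allRoots (1 : Ω) ∪ Set.range θ ∪ Set.range v) ≤ ⨆ M, R M := by
    refine Subfield.closure_le.2 ?_
    rintro x ((hx | ⟨i, rfl⟩) | ⟨l, rfl⟩)
    · obtain ⟨n, hn, hxn⟩ := hx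
      have : x ∈ R ⟨n, hn⟩ := Subfield.subset_closure (Or.inr hxn)
      exact (le_iSup R ⟨n, hn⟩) this
    · exact (le_iSup R 1) (Subfield.subset_closure (Or.inl (hθk i)))
    · exact (le_iSup R 1) (Subfield.subset_closure (Or.inl (hvk l)))
  obtain ⟨M, hyM⟩ := (Subfield.mem_iSup_of_directed hRdir).1 (hle hy)
  -- a primitive `M`-th root of unity and the field `E = k(ζ_M)`
  haveI : NeZero ((M : ℕ) : Ω) := NeZero.charZero
  obtain ⟨ζM, hζM⟩ := HasEnoughRootsOfUnity.prim (M := Ω) (n := (M : ℕ))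
  set E : IntermediateField k Ω := IntermediateField.adjoin k {ζM} with hE
  have hζMint : IsIntegral k ζM := (hζM.isIntegral M.pos).tower_top
  have hRE : R M ≤ E.toSubfield := by
    refine Subfield.closure_le.2 ?_
    rintro x (hx | hx)
    · exact E.algebraMap_mem ⟨x, hx⟩
    · change x ^ (M : ℕ) = 1 at hx
      obtain ⟨j, -, rfl⟩ := hζM.eq_pow_of_pow_eq_one hx
      exact pow_mem (IntermediateField.mem_adjoin_simple_self k ζM) j
  have hyE : y ∈ E := hRE hyM
  haveI hcyc : IsCyclotomicExtension {(M : ℕ)} k E := by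
    change IsCyclotomicExtension {(M : ℕ)} k (IntermediateField.adjoin k {ζM}).toSubalgebra
    rw [IntermediateField.adjoin_simple_toSubalgebra_of_isAlgebraic hζMint.isAlgebraic]
    exact hζM.adjoin_isCyclotomicExtension k
  haveI : FiniteDimensional k E := IsCyclotomicExtension.finite {(M : ℕ)} k E
  haveI : IsGalois k E := IsCyclotomicExtension.isGalois {(M : ℕ)} k E
  -- the Galois group is abelian
  have hζME : IsPrimitiveRoot (⟨ζM, IntermediateField.mem_adjoin_simple_self k ζM⟩ : E) M :=
    IsPrimitiveRoot.of_map_of_injective (f := algebraMap E Ω) (by exact hζM) (algebraMap E Ω).injective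
  have hcomm : ∀ σ τ : E ≃ₐ[k] E, σ * τ = τ * σ := fun σ τ =>
    hζME.autToPow_injective k (by rw [map_mul, map_mul, mul_comm])
  -- descent: `y ^ w = g θ'` with `g ∈ k`
  set yE : E := ⟨y, hyE⟩ with hyEdef
  have hprodk : (∏ l, v l ^ e l) ^ M' ∈ k := by
    refine pow_mem (prod_mem fun l _ => ?_) _
    exact zpow_mem (hvk l) _
  set a : k := ⟨(∏ l, v l ^ e l) ^ M', hprodk⟩ with ha
  have ha0 : a ≠ 0 := fun h => pow_ne_zero _ hprod0 (congrArg Subtype.val h)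
  have hx : yE ^ (N * M') = algebraMap k E a := by
    apply Subtype.ext
    change y ^ (N * M') = (∏ l, v l ^ e l) ^ M'
    rw [pow_mul, hrel, mul_pow, hζM', mul_one]
  obtain ⟨g, θ', hθ', hyw⟩ :=
    AbelianRadicalDescent.pow_eq_algebraMap_mul_rootOfUnity hcomm hwK (Nat.mul_pos hN hM') ha0 hx
  have hywΩ : y ^ w = (g : Ω) * (θ' : Ω) := by
    have := congrArg (algebraMap E Ω) hyw
    rw [map_pow, map_mul] at this
    exact this
  have hθ'Ω : (θ' : Ω) ^ (N * M') = 1 := by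
    have := congrArg (algebraMap E Ω) hθ'
    rwa [map_pow, map_one] at this
  have hθ'0 : (θ' : Ω) ≠ 0 := fun h => by
    rw [h, zero_pow (Nat.mul_pos hN hM').ne'] at hθ'Ω
    exact zero_ne_one hθ'Ω
  have hg0 : g ≠ 0 := by
    intro h
    rw [h] at hywΩ
    exact pow_ne_zero _ hy0 (by simpa using hywΩ)
  -- the relation `g ^ N = ζ'' ∏ vₗ ^ (w eₗ)` in `kˣ` with `ζ''` of finite order
  let gK : kˣ := Units.mk0 g hg0
  let P : kˣ := ∏ l, V l ^ ((w : ℤ) * e l)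
  let ZK : kˣ := gK ^ N * P⁻¹
  have hrelK : gK ^ N = (∏ l, V l ^ ((w : ℤ) * e l)) * ZK := by
    change gK ^ N = P * (gK ^ N * P⁻¹)
    rw [mul_comm (gK ^ N) P⁻¹, mul_inv_cancel_left]
  have hPcoe : algebraMap k Ω ((P : kˣ) : k) = (∏ l, v l ^ e l) ^ w := by
    change algebraMap k Ω (((∏ l, V l ^ ((w : ℤ) * e l) : kˣ) : k)) = _
    rw [hVcoe, ← Finset.prod_pow]
    refine Finset.prod_congr rfl fun l _ => ?_
    rw [mul_comm, zpow_mul, zpow_natCast]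
  have hZKcoe : algebraMap k Ω ((ZK : kˣ) : k) = ζ ^ w * ((θ' : Ω) ^ N)⁻¹ := by
    change algebraMap k Ω (((gK ^ N * P⁻¹ : kˣ) : k)) = _
    rw [Units.val_mul, map_mul, Units.val_inv_eq_inv_val, map_inv₀, hPcoe, Units.val_pow_eq_pow_val,
      map_pow]
    change (g : Ω) ^ N * ((∏ l, v l ^ e l) ^ w)⁻¹ = _
    have hgΩ : (g : Ω) = y ^ w * ((θ' : Ω))⁻¹ := by
      rw [hywΩ, mul_inv_cancel_right₀ hθ'0]
    rw [hgΩ, mul_pow, ← pow_mul, mul_comm w N, pow_mul, hrel, mul_pow, inv_pow]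
    field_simp
  have hZKfin : IsOfFinOrder ZK := by
    rw [isOfFinOrder_iff_pow_eq_one]
    refine ⟨M' * (N * M'), Nat.mul_pos hM' (Nat.mul_pos hN hM'), ?_⟩
    apply Units.ext
    apply (algebraMap k Ω).injective
    have h1 : ζ ^ (M' * (N * M')) = 1 := by rw [pow_mul, hζM', one_pow]
    have h2 : ((θ' : Ω) ^ N) ^ (M' * (N * M')) = 1 := by
      rw [← pow_mul, show N * (M' * (N * M')) = (N * M') * (N * M') by ring, pow_mul, hθ'Ω, one_pow]
    rw [Units.val_pow_eq_pow_val, map_pow, hZKcoe, Units.val_one, map_one, mul_pow, ← pow_mul,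
      mul_comm w, pow_mul, h1, one_pow, one_mul, inv_pow, h2, inv_one]
  have hdvd := hNF gK N (fun l => (w : ℤ) * e l) ZK hZKfin hrelK l
  rw [Nat.cast_mul, mul_assoc]
  exact hdvd

end CyclotomicRadicalBound

end Literature.FieldTheory.Kummer
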